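import Summits.AnomalousDissipation.AnomalousDissipation.Theorems.DriftStatesAreLerayHopf.Negative.DriftModeUnique
import Summits.AnomalousDissipation.AnomalousDissipation.Theorems.TwodBoundedEnergyZeroMomentum.Negative.FirstShellRigidity

/-!
# The invariant plane of a drifted single mode: explicit unsteady flow, its long-time means

Negative-lane file (small-model facts; no Theses statement is asserted). The steady drift states of
`DriftModeSteady` sit in a five-parameter family of data that is INVARIANT under the forced
Navier–Stokes flow: `W + a sin(2πk·x)v + b cos(2πk·x)v` (`⟪k,v⟫ = 0`, drift `W ∈ ℝ³`, amplitudes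
`a, b`). With the single-mode force `(μa⋆ − omb⋆) sin v + (μb⋆ + oma⋆) cos v` (`μ = νλ`, `λ = 4π²|k|²`,
`om = 2π⟪k,W⟫`; `(a⋆, b⋆)` the steady amplitudes) the amplitudes obey the linear ODE
`a' = −μ(a − a⋆) + om(b − b⋆)`, `b' = −μ(b − b⋆) − om(a − a⋆)` (advection by the drift rotates the
phase, viscosity damps towards `(a⋆, b⋆)`), solved by a decaying rotation
(`exists_driftPlane_amplitudes`). Results: the time-dependent field is a classical NS solution with
zero pressure (`isClassicalNSSolutionOn_driftPlane`), hence Leray–Hopf from its datum; its energy and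
dissipation at time `t` are `‖W‖² + ½‖v‖²(a(t)² + b(t)²)` and `νλ·½‖v‖²(a(t)² + b(t)²)`, and their
long-time means are the steady values `‖W‖² + ½‖v‖²(a⋆² + b⋆²)`, `νλ·½‖v‖²(a⋆² + b⋆²)`
(`meanEnergy_driftPlane`, `meanDissipation_driftPlane`; Cesàro limit of a convergent observable,
`TwodBoundedEnergyZeroMomentum.Negative.longTimeAvgSup_eq_of_tendsto`).
The transfer to EVERY Leray–Hopf solution from such data and the Kolmogorov corollary are in
`DriftPlaneUnique`.
-/

noncomputable section
-- the mandated namespace `Summit.<Summit>.<Problem>.Theorems` repeats `AnomalousDissipation` (single-problem summit)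
set_option linter.dupNamespace false

namespace Summit.AnomalousDissipation.AnomalousDissipation.Theorems.DriftStatesAreLerayHopf.Negative

open MeasureTheory Set Filter Topology UnitAddTorus
open scoped ENNReal NNReal InnerProductSpace ContDiff
open Literature.Analysis.FunctionSpaces Literature.Analysis.FunctionSpaces.Torus
open Literature.Analysis.FluidPDE Literature.Analysis.FluidPDE.Torus
open Summit.AnomalousDissipation.AnomalousDissipation.Theorems.RestMeanFloorTG.Negative
  (isSmoothSpaceTimeOn_ampMode)
open Summit.AnomalousDissipation.AnomalousDissipation.Theorems.TwodBoundedEnergyZeroMomentum.Negative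
  (longTimeAvgSup_eq_of_tendsto)

variable {k : Fin 3 → ℤ} {v : EuclideanSpace ℝ (Fin 3)}

/-! ## 1. Time-dependent amplitudes on the plane: the classical solution -/

/-- Joint smoothness of `(t, x) ↦ W + a(t) sin v + b(t) cos v`. [folklore] -/
theorem isSmoothSpaceTimeOn_driftPlane (k : Fin 3 → ℤ) (v W : EuclideanSpace ℝ (Fin 3)) {a b : ℝ → ℝ}
    (ha : ContDiff ℝ ∞ a) (hb : ContDiff ℝ ∞ b) :
    Literature.Analysis.FunctionSpaces.Torus.IsSmoothSpaceTimeOn univ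
      (fun t (x : UnitAddTorus (Fin 3)) => W + a t • stokesMode k v false x + b t • stokesMode k v true x) :=
  ((isSmoothSpaceTimeOn_const (isSmooth_const W) _).add (isSmoothSpaceTimeOn_ampMode k v false a ha)).add
    (isSmoothSpaceTimeOn_ampMode k v true b hb)

/-- `∂ₜ(W + a(t) sin v + b(t) cos v) = a'(t) sin v + b'(t) cos v`. [folklore] -/
theorem timeDerivWithin_driftPlane (k : Fin 3 → ℤ) (v W : EuclideanSpace ℝ (Fin 3)) {a b : ℝ → ℝ}
    {a' b' : ℝ} {t : ℝ} (ha : HasDerivAt a a' t) (hb : HasDerivAt b b' t) (x : UnitAddTorus (Fin 3)) :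
    Literature.Analysis.FunctionSpaces.Torus.timeDerivWithin univ
      (fun t (x : UnitAddTorus (Fin 3)) => W + a t • stokesMode k v false x + b t • stokesMode k v true x) t x =
      a' • stokesMode k v false x + b' • stokesMode k v true x := by
  unfold Literature.Analysis.FunctionSpaces.Torus.timeDerivWithin
  rw [derivWithin_univ]
  have h : HasDerivAt (fun s : ℝ => W + a s • stokesMode k v false x + b s • stokesMode k v true x)
      (0 + a' • stokesMode k v false x + b' • stokesMode k v true x) t :=
    ((hasDerivAt_const t W).add (ha.smul_const _)).add (hb.smul_const _)
  rw [h.deriv, zero_add]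

/-- **The drift plane is invariant and carries an explicit classical flow.** For `⟪k,v⟫ = 0`, drift
`W`, steady amplitudes `(a⋆, b⋆)`, viscosity `ν` and smooth amplitudes solving
`a' = −νλ(a − a⋆) + om(b − b⋆)`, `b' = −νλ(b − b⋆) − om(a − a⋆)` (`om = 2π⟪k,W⟫`), the field
`t ↦ W + a(t) sin v + b(t) cos v` is a classical NS solution on `ℝ × T³` with zero pressure and the
steady single-mode force `(νλa⋆ − omb⋆) sin v + (νλb⋆ + oma⋆) cos v`. [folklore] -/
theorem isClassicalNSSolutionOn_driftPlane (hkv : ⟪latticeVec k, v⟫_ℝ = 0) (W : EuclideanSpace ℝ (Fin 3))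
    (aS bS ν : ℝ) {a b : ℝ → ℝ} (ha : ContDiff ℝ ∞ a) (hb : ContDiff ℝ ∞ b)
    (hda : ∀ t, HasDerivAt a (-(ν * stokesEigenvalue k) * (a t - aS) +
      2 * Real.pi * ⟪latticeVec k, W⟫_ℝ * (b t - bS)) t)
    (hdb : ∀ t, HasDerivAt b (-(ν * stokesEigenvalue k) * (b t - bS) -
      2 * Real.pi * ⟪latticeVec k, W⟫_ℝ * (a t - aS)) t) :
    IsClassicalNSSolutionOn univ ν
      (fun _ (x : UnitAddTorus (Fin 3)) =>
        (ν * stokesEigenvalue k * aS - 2 * Real.pi * ⟪latticeVec k, W⟫_ℝ * bS) • stokesMode k v false x +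
          (ν * stokesEigenvalue k * bS + 2 * Real.pi * ⟪latticeVec k, W⟫_ℝ * aS) • stokesMode k v true x)
      (fun t (x : UnitAddTorus (Fin 3)) => W + a t • stokesMode k v false x + b t • stokesMode k v true x)
      (fun _ _ => (0 : ℝ)) where
  smooth_velocity := isSmoothSpaceTimeOn_driftPlane k v W ha hb
  smooth_pressure := isSmoothSpaceTimeOn_const (isSmooth_const (0 : ℝ)) _
  divFree t _ := isDivFree_driftMode hkv W (a t) (b t)
  momentum t _ x := by
    have hg : Torus.gradient (fun _ : UnitAddTorus (Fin 3) => (0 : ℝ)) x = 0 :=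
      gradient_fun_const (0 : EuclideanSpace ℝ (Fin 3)) (0 : ℝ)
    rw [timeDerivWithin_driftPlane k v W (hda t) (hdb t) x]
    show _ + Torus.convect (fun y => W + a t • stokesMode k v false y + b t • stokesMode k v true y)
        (fun y => W + a t • stokesMode k v false y + b t • stokesMode k v true y) x =
      ν • Torus.laplacian (fun y => W + a t • stokesMode k v false y + b t • stokesMode k v true y) x -
        Torus.gradient (fun _ : UnitAddTorus (Fin 3) => (0 : ℝ)) x + _
    rw [convect_driftMode_self hkv, laplacian_driftMode, hg, sub_zero, smul_add, smul_smul, smul_smul]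
    module

/-- **… hence a global Leray–Hopf solution from its datum `W + a(0) sin v + b(0) cos v`.** [folklore] -/
theorem isGlobalLerayHopf_driftPlane (hkv : ⟪latticeVec k, v⟫_ℝ = 0) (W : EuclideanSpace ℝ (Fin 3))
    (aS bS ν : ℝ) {a b : ℝ → ℝ} (ha : ContDiff ℝ ∞ a) (hb : ContDiff ℝ ∞ b)
    (hda : ∀ t, HasDerivAt a (-(ν * stokesEigenvalue k) * (a t - aS) +
      2 * Real.pi * ⟪latticeVec k, W⟫_ℝ * (b t - bS)) t)
    (hdb : ∀ t, HasDerivAt b (-(ν * stokesEigenvalue k) * (b t - bS) -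
      2 * Real.pi * ⟪latticeVec k, W⟫_ℝ * (a t - aS)) t) :
    IsGlobalLerayHopf ν
      (fun _ (x : UnitAddTorus (Fin 3)) =>
        (ν * stokesEigenvalue k * aS - 2 * Real.pi * ⟪latticeVec k, W⟫_ℝ * bS) • stokesMode k v false x +
          (ν * stokesEigenvalue k * bS + 2 * Real.pi * ⟪latticeVec k, W⟫_ℝ * aS) • stokesMode k v true x)
      (fun x : UnitAddTorus (Fin 3) => W + a 0 • stokesMode k v false x + b 0 • stokesMode k v true x)
      (fun t (x : UnitAddTorus (Fin 3)) => W + a t • stokesMode k v false x + b t • stokesMode k v true x) :=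
  (isClassicalNSSolutionOn_driftPlane hkv W aS bS ν ha hb hda hdb).isGlobalLerayHopf

/-! ## 2. The amplitude ODE: a decaying rotation about the steady point -/

/-- **Solution of the amplitude system.** For a damping rate `μ > 0`, rotation rate `om` and any
initial amplitudes there are smooth `a, b` with `a(0) = a₀`, `b(0) = b₀`,
`a' = −μ(a − a⋆) + om(b − b⋆)`, `b' = −μ(b − b⋆) − om(a − a⋆)`, and `a → a⋆`, `b → b⋆`
(explicitly `a − a⋆ = e^{−μt}((a₀ − a⋆) cos omt + (b₀ − b⋆) sin omt)`,
`b − b⋆ = e^{−μt}((b₀ − b⋆) cos omt − (a₀ − a⋆) sin omt)`). [folklore] -/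
theorem exists_driftPlane_amplitudes {μ : ℝ} (hμ : 0 < μ) (om aS bS a₀ b₀ : ℝ) :
    ∃ a b : ℝ → ℝ, ContDiff ℝ ∞ a ∧ ContDiff ℝ ∞ b ∧ a 0 = a₀ ∧ b 0 = b₀ ∧
      (∀ t, HasDerivAt a (-μ * (a t - aS) + om * (b t - bS)) t) ∧
      (∀ t, HasDerivAt b (-μ * (b t - bS) - om * (a t - aS)) t) ∧
      Tendsto a atTop (𝓝 aS) ∧ Tendsto b atTop (𝓝 bS) := by
  set p₀ := a₀ - aS with hp₀
  set q₀ := b₀ - bS with hq₀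
  refine ⟨fun t => aS + Real.exp (-(μ * t)) * (p₀ * Real.cos (om * t) + q₀ * Real.sin (om * t)),
    fun t => bS + Real.exp (-(μ * t)) * (q₀ * Real.cos (om * t) - p₀ * Real.sin (om * t)),
    ?_, ?_, ?_, ?_, ?_, ?_, ?_, ?_⟩
  · fun_prop
  · fun_prop
  · simp [hp₀]
  · simp [hq₀]
  · intro t
    have he : HasDerivAt (fun s : ℝ => Real.exp (-(μ * s))) (Real.exp (-(μ * t)) * -(μ * 1)) t :=
      ((hasDerivAt_id' t).const_mul μ).neg.exp
    have hc : HasDerivAt (fun s : ℝ => Real.cos (om * s)) (-Real.sin (om * t) * (om * 1)) t :=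
      ((hasDerivAt_id' t).const_mul om).cos
    have hs : HasDerivAt (fun s : ℝ => Real.sin (om * s)) (Real.cos (om * t) * (om * 1)) t :=
      ((hasDerivAt_id' t).const_mul om).sin
    have h := (hasDerivAt_const t aS).add (he.mul ((hc.const_mul p₀).add (hs.const_mul q₀)))
    refine h.congr_deriv ?_
    simp only [Pi.add_apply]
    ring
  · intro t
    have he : HasDerivAt (fun s : ℝ => Real.exp (-(μ * s))) (Real.exp (-(μ * t)) * -(μ * 1)) t :=
      ((hasDerivAt_id' t).const_mul μ).neg.exp
    have hc : HasDerivAt (fun s : ℝ => Real.cos (om * s)) (-Real.sin (om * t) * (om * 1)) t :=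
      ((hasDerivAt_id' t).const_mul om).cos
    have hs : HasDerivAt (fun s : ℝ => Real.sin (om * s)) (Real.cos (om * t) * (om * 1)) t :=
      ((hasDerivAt_id' t).const_mul om).sin
    have h := (hasDerivAt_const t bS).add (he.mul ((hc.const_mul q₀).sub (hs.const_mul p₀)))
    refine h.congr_deriv ?_
    simp only [Pi.sub_apply]
    ring
  · have h0 : Tendsto (fun t : ℝ => Real.exp (-(μ * t)) * (p₀ * Real.cos (om * t) + q₀ * Real.sin (om * t)))
        atTop (𝓝 0) := by
      have hexp : Tendsto (fun t : ℝ => Real.exp (-(μ * t))) atTop (𝓝 0) :=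
        Real.tendsto_exp_neg_atTop_nhds_zero.comp (tendsto_id.const_mul_atTop hμ)
      refine squeeze_zero_norm (fun t => ?_) (by simpa using hexp.mul_const (|p₀| + |q₀|))
      rw [norm_mul, Real.norm_eq_abs, Real.norm_eq_abs, abs_of_pos (Real.exp_pos _)]
      gcongr
      calc |p₀ * Real.cos (om * t) + q₀ * Real.sin (om * t)|
          ≤ |p₀ * Real.cos (om * t)| + |q₀ * Real.sin (om * t)| := abs_add_le _ _
        _ ≤ |p₀| * 1 + |q₀| * 1 := by
            rw [abs_mul, abs_mul]
            gcongr
            · exact Real.abs_cos_le_one _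
            · exact Real.abs_sin_le_one _
        _ = |p₀| + |q₀| := by ring
    simpa using h0.const_add aS
  · have h0 : Tendsto (fun t : ℝ => Real.exp (-(μ * t)) * (q₀ * Real.cos (om * t) - p₀ * Real.sin (om * t)))
        atTop (𝓝 0) := by
      have hexp : Tendsto (fun t : ℝ => Real.exp (-(μ * t))) atTop (𝓝 0) :=
        Real.tendsto_exp_neg_atTop_nhds_zero.comp (tendsto_id.const_mul_atTop hμ)
      refine squeeze_zero_norm (fun t => ?_) (by simpa using hexp.mul_const (|q₀| + |p₀|))
      rw [norm_mul, Real.norm_eq_abs, Real.norm_eq_abs, abs_of_pos (Real.exp_pos _)]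
      gcongr
      calc |q₀ * Real.cos (om * t) - p₀ * Real.sin (om * t)|
          ≤ |q₀ * Real.cos (om * t)| + |p₀ * Real.sin (om * t)| := abs_sub _ _
        _ ≤ |q₀| * 1 + |p₀| * 1 := by
            rw [abs_mul, abs_mul]
            gcongr
            · exact Real.abs_cos_le_one _
            · exact Real.abs_sin_le_one _
        _ = |q₀| + |p₀| := by ring
    simpa using h0.const_add bS

/-! ## 3. Energy and dissipation along the plane flow; long-time means -/

/-- Energy at time `t`: `∫ ‖W + a(t) sin v + b(t) cos v‖² = ‖W‖² + ½‖v‖²(a(t)² + b(t)²)`. [folklore] -/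
theorem integral_norm_sq_driftPlane (hk : k ≠ 0) (v W : EuclideanSpace ℝ (Fin 3)) (a b : ℝ → ℝ) (t : ℝ) :
    ∫ x, ‖(fun t (x : UnitAddTorus (Fin 3)) => W + a t • stokesMode k v false x + b t • stokesMode k v true x) t x‖ ^ 2 =
      ‖W‖ ^ 2 + ‖v‖ ^ 2 / 2 * (a t ^ 2 + b t ^ 2) :=
  integral_norm_sq_driftMode hk v W (a t) (b t)

/-- Dissipation density at time `t`: `ν‖∇(·)‖₂² = νλ·½‖v‖²(a(t)² + b(t)²)` (spectral form). [folklore] -/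
theorem toReal_eGradNormSq_driftPlane (hk : k ≠ 0) (v W : EuclideanSpace ℝ (Fin 3)) (a b : ℝ → ℝ) (ν t : ℝ) :
    ν * (eGradNormSq ((fun t (x : UnitAddTorus (Fin 3)) =>
        W + a t • stokesMode k v false x + b t • stokesMode k v true x) t)).toReal =
      ν * (stokesEigenvalue k * (‖v‖ ^ 2 / 2 * (a t ^ 2 + b t ^ 2))) := by
  rw [← gradNormSq_eq_toReal_eGradNormSq_holds (isSmooth_driftMode k v W (a t) (b t)), gradNormSq_driftMode hk]

/-- **Mean energy of the plane flow** `= ‖W‖² + ½‖v‖²(a⋆² + b⋆²)` when `a → a⋆`, `b → b⋆`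
(Cesàro limit of a convergent continuous observable). [folklore] -/
theorem meanEnergy_driftPlane (hk : k ≠ 0) (v W : EuclideanSpace ℝ (Fin 3)) {a b : ℝ → ℝ} {aS bS : ℝ}
    (hac : Continuous a) (hbc : Continuous b) (ha : Tendsto a atTop (𝓝 aS)) (hb : Tendsto b atTop (𝓝 bS)) :
    meanEnergy (fun t (x : UnitAddTorus (Fin 3)) => W + a t • stokesMode k v false x + b t • stokesMode k v true x) =
      ‖W‖ ^ 2 + ‖v‖ ^ 2 / 2 * (aS ^ 2 + bS ^ 2) := by
  rw [meanEnergy_eq_longTimeAvgSup]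
  have hfun : (fun t => ∫ x, ‖(fun t (x : UnitAddTorus (Fin 3)) =>
      W + a t • stokesMode k v false x + b t • stokesMode k v true x) t x‖ ^ 2) =
      fun t => ‖W‖ ^ 2 + ‖v‖ ^ 2 / 2 * (a t ^ 2 + b t ^ 2) :=
    funext fun t => integral_norm_sq_driftPlane hk v W a b t
  rw [hfun]
  have hcont : Continuous fun t => ‖W‖ ^ 2 + ‖v‖ ^ 2 / 2 * (a t ^ 2 + b t ^ 2) := by fun_prop
  refine longTimeAvgSup_eq_of_tendsto (fun T _ => hcont.integrableOn_Ioc) ?_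
  exact ((ha.pow 2).add (hb.pow 2)).const_mul _ |>.const_add _

/-- **Mean dissipation of the plane flow** `= νλ·½‖v‖²(a⋆² + b⋆²)`. [folklore] -/
theorem meanDissipation_driftPlane (hk : k ≠ 0) (v W : EuclideanSpace ℝ (Fin 3)) {a b : ℝ → ℝ} {aS bS : ℝ}
    (ν : ℝ) (hac : Continuous a) (hbc : Continuous b) (ha : Tendsto a atTop (𝓝 aS)) (hb : Tendsto b atTop (𝓝 bS)) :
    meanDissipation ν (fun t (x : UnitAddTorus (Fin 3)) =>
        W + a t • stokesMode k v false x + b t • stokesMode k v true x) =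
      ν * (stokesEigenvalue k * (‖v‖ ^ 2 / 2 * (aS ^ 2 + bS ^ 2))) := by
  unfold meanDissipation
  have hfun : (fun t => ν * (eGradNormSq ((fun t (x : UnitAddTorus (Fin 3)) =>
      W + a t • stokesMode k v false x + b t • stokesMode k v true x) t)).toReal) =
      fun t => ν * (stokesEigenvalue k * (‖v‖ ^ 2 / 2 * (a t ^ 2 + b t ^ 2))) :=
    funext fun t => toReal_eGradNormSq_driftPlane hk v W a b ν t
  rw [hfun]
  have hcont : Continuous fun t => ν * (stokesEigenvalue k * (‖v‖ ^ 2 / 2 * (a t ^ 2 + b t ^ 2))) := by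
    fun_prop
  refine longTimeAvgSup_eq_of_tendsto (fun T _ => hcont.integrableOn_Ioc) ?_
  exact (((ha.pow 2).add (hb.pow 2)).const_mul _).const_mul _ |>.const_mul _

end Summit.AnomalousDissipation.AnomalousDissipation.Theorems.DriftStatesAreLerayHopf.Negative

end
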